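import Summits.CriticalPhenomena.PercolationContinuityZ3.Theorems.Transplant.TransitiveTriangleGammaOne
import Summits.CriticalPhenomena.PercolationContinuityZ3.Theorems.Transplant.GrigorchukPowerGrowth
import Summits.CriticalPhenomena.PercolationContinuityZ3.Theorems.Transplant.GrigorchukPowerSmallParam
import Literature.Probability.Percolation.GrimmettMarstrand
import HarnessLib

/-!
# W4 — THE TRIANGLE DOOR IS DISCHARGED: `triangleDoorGk_holds (k) : TriangleDoorGk k` (`TriangleCond (Cay(𝔊^k; std)) → gkCay_conj4 k`), unconditional

Proof file (`--supports stmt-CriticalPhenomena-4575 --as helper`), lane `prim-bschramm`, seat `prim-bschramm-gen-1` gen 13 (GEN pen); item (e), the last item of the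
Q-DOOR-2 port table (NOTES-g12-mirror §HANDOFF-QDOOR2; lead g29 #10068 / R-584-1 #10150; design desk p3 g43: v1.9 of the W4 skeleton drops `hDoor` with this decl).
DEFS-A «GrigorchukPowerNcHaraSladeDefs» p704571 types the door `TriangleDoorGk (k) : Prop := TriangleCond (gkCay k) → gkCay_conj4 k` as a NAMED-FACT-shaped
hypothesis of the W4 composition (Barsky–Aizenman 1991 / Hutchcroft 2022 for unimodular transitive graphs).  This file DISCHARGES it from the tree: the generic
door «TransitiveTriangleGammaOne» `theta_criticalProb_eq_zero_of_triangleCond` (Hutchcroft's Props. 1.6–1.7 ⇒ `γ ≤ 1` ⇒ Thm. 1.3, ported by the GEN lineage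
g12/g13 over (a) (b1) (b2a) (b2b) (b3) (c1)–(c3) + the MTP bridge) applied to `Cay(𝔊^k; std)`, whose standing hypotheses are all KERNEL: connected
(`gkCay_connected`), vertex-transitive (`gkCay_isGraphTransitive`, E4.3c), `4k`-regular (`gkCay_degree`), subexponential growth (`gkCay_not_hasExponentialGrowth`,
p686057) and `p_c < 1` for `k ≥ 1` (`gkCay_criticalProb_lt_one`); `k = 0` is the one-vertex graph, where `θ ≡ 0` («GrimmettMarstrand» `theta_eq_zero_of_finite`).
builds on p205010 (kernel theorem, internal audit signed; external expert review pending) — nothing here uses p205010.  Def-free; no instance, no notation, no sorry.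
MUST-NOT: this does NOT prove `θ(p_c) = 0` on any `Cay(𝔊^k)` — it proves the IMPLICATION from the triangle condition, which is NOT asserted (it is the output the
W4 line's open stubs S3a′/S3b′ + P1/P2 would deliver); `gkCay_conj4 k`, the residue node and `…conj4_endState` stay OPEN.
[cite: Hutchcroft2022Triangle, Thm. 1.1 and Thm. 1.3] [cite: BarskyAizenman1991, Thm. 1.1] [cite: BenjaminiSchramm1996, Conj. 4 and §2 (Cayley graphs)]
-/

noncomputable section

namespace Summit.CriticalPhenomena.PercolationContinuityZ3.Theorems.Transplant

namespace Grigorchuk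

namespace NcHaraSlade

open SimpleGraph Literature.Probability.Percolation Literature.Barriers.CriticalPhenomena
open scoped Classical

/-- **`θ_v(p_c) = 0` at every vertex of `Cay(𝔊^k; std)`, `k ≥ 1`, GIVEN the triangle condition there** (the generic door at `D = 4k`). The triangle condition is a
HYPOTHESIS; nothing asserts it. [cite: Hutchcroft2022Triangle, Thm. 1.1 and Thm. 1.3] [cite: BarskyAizenman1991, Thm. 1.1] -/
theorem gkCay_theta_criticalProb_eq_zero_of_triangleCond {k : ℕ} (hk : 1 ≤ k) (hT : TriangleCond (gkCay k)) (v : GPow k) :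
    theta (gkCay k) v (criticalProbIOf (gkCay k) v) = 0 :=
  theta_criticalProb_eq_zero_of_triangleCond (gkCay k) (gkCay_isGraphTransitive k) (gkCay_connected k) (gkCay_not_hasExponentialGrowth k)
    (D := 4 * k) (by omega) (fun a => (gkCay_degree k a).le) hT v (gkCay_criticalProb_lt_one hk v)

/-- **THE TRIANGLE DOOR ON `Cay(𝔊^k; std)` DISCHARGED — `TriangleDoorGk k` HOLDS for every `k`**: the triangle condition implies `gkCay_conj4 k` (`θ_v(p_c) = 0` at every vertex).
`k ≥ 1`: the generic door; `k = 0`: the one-vertex graph percolates nowhere.  The W4 composition's `hDoor` hypothesis is hereby discharged; `gkCay_conj4 k` itself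
stays OPEN (the triangle condition on `Cay(𝔊^k)` is not proved). [cite: Hutchcroft2022Triangle, Thm. 1.1 and Thm. 1.3] [cite: BenjaminiSchramm1996, Conj. 4] -/
theorem triangleDoorGk_holds (k : ℕ) : TriangleDoorGk k := by
  intro hT v
  rcases Nat.eq_zero_or_pos k with hk | hk
  · subst hk
    haveI : Subsingleton (GPow 0) := inferInstance
    exact theta_eq_zero_of_finite (gkCay 0) v _
  · exact gkCay_theta_criticalProb_eq_zero_of_triangleCond hk hT v

end NcHaraSlade

end Grigorchuk

end Summit.CriticalPhenomena.PercolationContinuityZ3.Theorems.Transplant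

end
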